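import Literature.NumberTheory.Automorphic.UnitaryGroupRankOneIwahoriDatum          -- ★ the `N = 3` original (imports: factorisation, congruence, big cell, torus commutativity)
import Literature.NumberTheory.Automorphic.UnitaryGroupRayJacquetCriterionAnyRank    -- ★ `AnyRank.diag_conj_mem_of_mem`, `AnyRank.exists_mem_rayLevel`, `AnyRank.isCompact_comap_glInt`
import HarnessLib

/-!
# F0 · P3c · road (D) «IWAHORI-U2★» (U2-A), PART 1 (algebra): the Borel of the quasi-split `U(σ, Φ_N)(K)` at ANY RANK `N` — the Weyl element,
# dominance of EVERY dominant diagonal on `N` and on `N̄ = w₀Nw₀`, normality of the levels in `U ∩ GL_N(𝒪)`, the Iwahori factorisation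
# `K = (K ∩ N̄)(K ∩ T)(K ∩ N)` and the `N̄·T·N` uniqueness [Casselman1995, Prop. 1.4.3, Prop. 1.4.4; BruhatTits1972, (4.4.3)–(4.4.4)]

Cell `pub/hodgecm-mathlib`, crux H413 = `stmt-HodgeConjecture-24833` (`--supports`, helper lane), route HCCMUnconditional; seat LH6-p05 (g2); road (D) owner
LH6-p04 (g3) DEAL «IWAHORI-U2★» (U2-A) 2026-09-02T06:40:03Z, ruling (G) 06:44:04Z.  THEOREMS ONLY: no `def`, no instance, no notation, no named fact, no sorry.
THE POINT.  ★ `Literature/NumberTheory/Automorphic/UnitaryGroupRankOneIwahoriDatum` (F0P3-p01) builds the Iwahori datum of the Borel of `U(σ,Φ₃)(K)` with the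
size pinned to `Fin 3`; its mathematics is rank-free (the rank-free contraction algebra is ★ `UnitaryGroupRayJacquetCriterionAnyRank`).  This file is the SAME
construction at an arbitrary rank `N` (proofs transported verbatim, `3 ↦ N`).  THIS PART 1 holds the algebra over any field with a `ValuativeRel` (one namespace
`…F0P3cIwahoriDatumU2` across both parts); PART 2 (`Theorems/F0P3cIwahoriDatumU2.lean`) adds the topology over a non-archimedean local field: compact open levels,
exhaustion, the neighbourhood basis, the datum as an EXISTENCE theorem exposing ray ∕ opposite radical ∕ levels (`exists_iwahoriDatumU`), the dominance package at
EVERY dominant diagonal (`dominant_package`) and the `N = 2` specialisations for the H-side `U(Φ₂)(L⁺_v)` of road (D) ((U2-B) LH4-p02, (U2-C) LH1-p03).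
DOMINANT means `|u_i∕u_j| ≤ q` for `i < j` (valuations INCREASING down the diagonal; at `N = 2`: `|e₀| < |e₁|`).
* §1: `diagPart_mem_congruenceGL`, `coe_weylConj_apply`, `coe_weylConj_of_eq_glDiagonal`, `weylLongU_inv_eq` (`w₀⁻¹ = w₀`), `weylLongU_mem_intLevel` (`w₀ ∈ K₀`),
  `weylConj_mem_level`, `level_normal` (`K₀` normalises every level), `dominant_conj_mem_level` (haN ∕ hbN), `dominant_pow_conj_mem`, `coe_weylConj_inv_eq_glDiagonal`,
  `inv_rev_ratio_le`, `dominant_inv_conj_mem_Nbar` (haNbar ∕ hbNbar, quantitative), `dominant_pow_inv_conj_mem_Nbar`, `coe_level_eq_mul` (Iwahori factorisation),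
  `coe_mem_opposite_of_mem_Nbar`, `coe_mem_opposite_of_mem_M`, `nbar_torus_unipotent_inj` (hinj).
HONEST LABEL: count-neutral; HC_CM is proved only modulo the 7 printed citations (2 remaining: hLiu418 = stmt-HodgeConjecture-24832, h413 = stmt-HodgeConjecture-24833)
until rung 0 closes.

## References
* [Casselman1995] W. Casselman, *Introduction to the theory of admissible representations of `p`-adic reductive groups* (1995 notes), Prop. 1.4.3, Prop. 1.4.4,
  proof of Thm. 5.3.1.
* [BruhatTits1972] F. Bruhat, J. Tits, *Groupes réductifs sur un corps local I*, Publ. Math. IHÉS 41 (1972), (4.4.3)–(4.4.4).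
* [BernsteinZelevinsky1976] I. N. Bernstein, A. V. Zelevinsky, Russian Math. Surveys 31:3 (1976), §3.13.
* [Rogawski1990] J. D. Rogawski, *Automorphic Representations of Unitary Groups in Three Variables* (1990), §1.10 p. 9, §4.4 p. 49.
-/

set_option autoImplicit false
-- the mandated namespace has the single-problem summit's repeated segment (`HodgeConjecture.HodgeConjecture`)
set_option linter.dupNamespace false

noncomputable section

open scoped MatrixGroups Pointwise Topology
open ValuativeRel Matrix
open Literature.NumberTheory.Automorphic Literature.NumberTheory.Automorphic.UnitaryGroup

namespace Summit.HodgeConjecture.HodgeConjecture.Cruxes.H413.F0P3cIwahoriDatumU2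

/-! ## §1 Algebra over a field with a `ValuativeRel` (any rank `N`) -/

section Alg

variable {K : Type*} [Field K] [ValuativeRel K] (σ : K →+* K) {N : ℕ} {J : Matrix (Fin N) (Fin N) K}
  (hJ : J = (StdForm.antidiagonal N).over K)

omit σ in
/-- **The diagonal part of an element of `K_γ` (`γ < 1`) lies in `K_γ`** (any rank). [cite: Casselman1995, Prop. 1.4.4] -/
theorem diagPart_mem_congruenceGL {γ : ValueGroupWithZero K} (hγ : γ < 1) {g : GL (Fin N) K} (hg : g ∈ congruenceGL N γ)
    (d : Fin N → Kˣ) (hd : ∀ i, (d i : K) = (g : Matrix (Fin N) (Fin N) K) i i) : glDiagonal N K d ∈ congruenceGL N γ := by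
  obtain ⟨⟨h1, -⟩, h2, -⟩ := mem_congruenceGL_iff.1 hg
  have hsub : ∀ i, valuation K ((d i : K) - 1) ≤ γ := fun i => by
    have := h2 i i
    rwa [Matrix.sub_apply, Matrix.one_apply_eq, ← hd i] at this
  have hone : ∀ i, valuation K (d i : K) = 1 := fun i => by
    have h : (d i : K) = 1 + ((d i : K) - 1) := by ring
    rw [h, Valuation.map_add_eq_of_lt_left] <;> rw [Valuation.map_one]
    exact lt_of_le_of_lt (hsub i) hγ
  have hinv : ∀ i, valuation K ((d i : K)⁻¹ - 1) ≤ γ := fun i => by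
    have h : ((d i : K))⁻¹ - 1 = (d i : K)⁻¹ * (1 - (d i : K)) := by
      rw [mul_sub, mul_one, inv_mul_cancel₀ (d i).ne_zero]
    rw [h, Valuation.map_mul, map_inv₀, hone i, inv_one, one_mul, Valuation.map_sub_swap]
    exact hsub i
  refine mem_congruenceGL_iff.2 ⟨⟨fun i j => ?_, fun i j => ?_⟩, fun i j => ?_, fun i j => ?_⟩
  · rw [coe_glDiagonal, Matrix.diagonal_apply]
    split_ifs with h
    · rw [hone]
    · rw [Valuation.map_zero]; exact zero_le
  · rw [← map_inv, coe_glDiagonal, Matrix.diagonal_apply]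
    split_ifs with h
    · rw [Pi.inv_apply, Units.val_inv_eq_inv_val, map_inv₀, hone, inv_one]
    · rw [Valuation.map_zero]; exact zero_le
  · rw [coe_glDiagonal, Matrix.sub_apply, Matrix.diagonal_apply, Matrix.one_apply]
    split_ifs with h
    · exact hsub i
    · rw [sub_zero, Valuation.map_zero]; exact zero_le
  · rw [← map_inv, coe_glDiagonal, Matrix.sub_apply, Matrix.diagonal_apply, Matrix.one_apply]
    split_ifs with h
    · rw [Pi.inv_apply, Units.val_inv_eq_inv_val]; exact hinv i
    · rw [sub_zero, Valuation.map_zero]; exact zero_le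

omit [ValuativeRel K] in
/-- The matrix of `w₀ x w₀` (inside `U`, any rank): `(w₀ x w₀)_{ij} = x_{rev i, rev j}`. [cite: Rogawski1990, §1.10 p. 9] -/
theorem coe_weylConj_apply (x : ↥(unitaryGroupOfForm σ J)) (i j : Fin N) :
    (((weylLongU σ hJ * x * weylLongU σ hJ : ↥(unitaryGroupOfForm σ J)) : GL (Fin N) K) : Matrix (Fin N) (Fin N) K) i j =
      (((x : ↥(unitaryGroupOfForm σ J)) : GL (Fin N) K) : Matrix (Fin N) (Fin N) K) i.rev j.rev := by
  rw [Subgroup.coe_mul, Subgroup.coe_mul, Units.val_mul, Units.val_mul, coe_weylLongU, weylLong_conj_apply]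

omit [ValuativeRel K] in
/-- `w₀ diag(w) w₀ = diag(w ∘ rev)` inside `U` (any rank). [cite: Rogawski1990, §1.10 p. 9] -/
theorem coe_weylConj_of_eq_glDiagonal {x : ↥(unitaryGroupOfForm σ J)} {w : Fin N → Kˣ}
    (hx : ((x : ↥(unitaryGroupOfForm σ J)) : GL (Fin N) K) = glDiagonal N K w) :
    ((weylLongU σ hJ * x * weylLongU σ hJ : ↥(unitaryGroupOfForm σ J)) : GL (Fin N) K) = glDiagonal N K (w ∘ Fin.rev) := by
  apply Units.ext
  ext i j
  rw [coe_weylConj_apply, hx, coe_glDiagonal, coe_glDiagonal, Matrix.diagonal_apply, Matrix.diagonal_apply]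
  simp only [Function.comp_apply, Fin.rev_inj]

omit [ValuativeRel K] in
/-- `w₀⁻¹ = w₀` in `U(σ, Φ_N)(K)` (any rank; `w₀ w₀ = 1` ★ `weylLong_mul_weylLong` — at `N = 3` this is ★ `weylLongU_mul_weylLongU`; use
`mul_eq_one_iff_eq_inv.2 (weylLongU_inv_eq σ hJ).symm : w₀ * w₀ = 1`). [cite: Rogawski1990, §1.10 p. 9] -/
theorem weylLongU_inv_eq : (weylLongU σ hJ)⁻¹ = weylLongU σ hJ := by
  have hsq : weylLongU σ hJ * weylLongU σ hJ = 1 := by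
    apply Subtype.ext
    apply Units.ext
    change (((weylLongU σ hJ : ↥(unitaryGroupOfForm σ J)) : GL (Fin N) K) : Matrix (Fin N) (Fin N) K) *
      (((weylLongU σ hJ : ↥(unitaryGroupOfForm σ J)) : GL (Fin N) K) : Matrix (Fin N) (Fin N) K) = 1
    rw [coe_weylLongU]
    exact weylLong_mul_weylLong
  exact (eq_inv_of_mul_eq_one_left hsq).symm

/-- **`w₀ ∈ K₀ = U ∩ GL_N(𝒪)`** (a permutation matrix, `w₀⁻¹ = w₀`; any rank). [cite: Rogawski1990, §1.10 p. 9] -/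
theorem weylLongU_mem_intLevel : weylLongU σ hJ ∈ (glInt N K).comap (unitaryGroupOfForm σ J).subtype := by
  have hentry : ∀ i j, valuation K ((((weylLong N K : GL (Fin N) K)) : Matrix (Fin N) (Fin N) K) i j) ≤ 1 := by
    intro i j
    rw [coe_weylLong, Equiv.Perm.permMatrix, PEquiv.toMatrix_apply]
    split_ifs
    · rw [map_one]
    · rw [map_zero]; exact zero_le
  show ((weylLongU σ hJ : ↥(unitaryGroupOfForm σ J)) : GL (Fin N) K) ∈ glInt N K
  rw [coe_weylLongU]
  refine mem_glInt_of_forall_valuation_le_one hentry fun i j => ?_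
  rw [weylLong_inv]
  exact hentry i j

/-- `w₀ x w₀ ∈ K_γ ∩ U` for `x ∈ K_γ ∩ U` (any rank). [cite: Casselman1995, Prop. 1.4.4] -/
theorem weylConj_mem_level {γ : ValueGroupWithZero K} {x : ↥(unitaryGroupOfForm σ J)}
    (hx : x ∈ (congruenceGL N γ).comap (unitaryGroupOfForm σ J).subtype) :
    weylLongU σ hJ * x * weylLongU σ hJ ∈ (congruenceGL N γ).comap (unitaryGroupOfForm σ J).subtype := by
  have hre : weylLongU σ hJ * x * weylLongU σ hJ = weylLongU σ hJ * x * (weylLongU σ hJ)⁻¹ := by rw [weylLongU_inv_eq]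
  rw [hre]
  rw [Subgroup.mem_comap] at hx ⊢
  rw [Subgroup.coe_subtype, Subgroup.coe_mul, Subgroup.coe_mul, Subgroup.coe_inv]
  exact conj_mem_congruenceGL (Subgroup.mem_comap.1 (weylLongU_mem_intLevel σ hJ)) hx

omit hJ in
/-- `k⁻¹ κ k ∈ K_γ ∩ U` for `k ∈ K₀ = U ∩ GL_N(𝒪)`, `κ ∈ K_γ ∩ U`: the levels are NORMALISED by `K₀` (any rank). [cite: Casselman1995, Prop. 1.4.4] -/
theorem level_normal {γ : ValueGroupWithZero K} {k κ : ↥(unitaryGroupOfForm σ J)}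
    (hk : k ∈ (glInt N K).comap (unitaryGroupOfForm σ J).subtype) (hκ : κ ∈ (congruenceGL N γ).comap (unitaryGroupOfForm σ J).subtype) :
    k⁻¹ * κ * k ∈ (congruenceGL N γ).comap (unitaryGroupOfForm σ J).subtype := by
  rw [Subgroup.mem_comap] at hk hκ ⊢
  rw [Subgroup.coe_subtype, Subgroup.coe_mul, Subgroup.coe_mul, Subgroup.coe_inv]
  have h := conj_mem_congruenceGL ((glInt N K).inv_mem hk) hκ
  rwa [inv_inv] at h

/-- **Dominance on `N` (`haN` ∕ `hbN`, any rank, any dominant diagonal)**: conjugation by `s = diag(u) ∈ U` with `|u_i/u_j| ≤ q ≤ 1` (`i < j`) maps `K_γ ∩ N` into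
`K_γ` (★ `AnyRank.diag_conj_mem_of_mem`). [cite: Casselman1995, Prop. 1.4.3, Prop. 1.4.4] -/
theorem dominant_conj_mem_level {q γ : ValueGroupWithZero K} (hγ : γ < 1) (hq : q ≤ 1) (s : ↥(unitaryGroupOfForm σ J))
    (u : Fin N → Kˣ) (hs : ((s : ↥(unitaryGroupOfForm σ J)) : GL (Fin N) K) = glDiagonal N K u)
    (hu : ∀ i j : Fin N, i < j → valuation K ((u i : K) * ((u j : K))⁻¹) ≤ q) {x : ↥(unitaryGroupOfForm σ J)}
    (hx : x ∈ (congruenceGL N γ).comap (unitaryGroupOfForm σ J).subtype ⊓ (borelTriple σ J hJ).N) :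
    s * x * s⁻¹ ∈ (congruenceGL N γ).comap (unitaryGroupOfForm σ J).subtype :=
  (Subgroup.mem_inf.1 (AnyRank.diag_conj_mem_of_mem σ hJ hγ ((mul_le_mul' hq le_rfl).trans (one_mul γ).le) s u hs hu hx)).1

/-- **Powers stay dominant on `N`** (any rank): `sᵏ (K_γ ∩ N) s⁻ᵏ ⊆ K_γ ∩ N`. [cite: Casselman1995, Prop. 1.4.3] -/
theorem dominant_pow_conj_mem {q γ : ValueGroupWithZero K} (hγ : γ < 1) (hq : q ≤ 1) (s : ↥(unitaryGroupOfForm σ J))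
    (u : Fin N → Kˣ) (hs : ((s : ↥(unitaryGroupOfForm σ J)) : GL (Fin N) K) = glDiagonal N K u)
    (hu : ∀ i j : Fin N, i < j → valuation K ((u i : K) * ((u j : K))⁻¹) ≤ q) (k : ℕ) {x : ↥(unitaryGroupOfForm σ J)}
    (hx : x ∈ (congruenceGL N γ).comap (unitaryGroupOfForm σ J).subtype ⊓ (borelTriple σ J hJ).N) :
    s ^ k * x * (s ^ k)⁻¹ ∈ (congruenceGL N γ).comap (unitaryGroupOfForm σ J).subtype ⊓ (borelTriple σ J hJ).N := by
  induction k with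
  | zero => simpa using hx
  | succ k ih =>
    have hre : s ^ (k + 1) * x * (s ^ (k + 1))⁻¹ = s * (s ^ k * x * (s ^ k)⁻¹) * s⁻¹ := by rw [pow_succ']; group
    rw [hre]
    exact AnyRank.diag_conj_mem_of_mem σ hJ hγ ((mul_le_mul' hq le_rfl).trans (one_mul γ).le) s u hs hu ih

omit [ValuativeRel K] in
/-- `w₀ s⁻¹ w₀ = diag(u⁻¹ ∘ rev)` for `s = diag(u)` (any rank). [cite: Rogawski1990, §1.10 p. 9] -/
theorem coe_weylConj_inv_eq_glDiagonal {s : ↥(unitaryGroupOfForm σ J)} {u : Fin N → Kˣ}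
    (hs : ((s : ↥(unitaryGroupOfForm σ J)) : GL (Fin N) K) = glDiagonal N K u) :
    ((weylLongU σ hJ * s⁻¹ * weylLongU σ hJ : ↥(unitaryGroupOfForm σ J)) : GL (Fin N) K) = glDiagonal N K (u⁻¹ ∘ Fin.rev) :=
  coe_weylConj_of_eq_glDiagonal σ hJ (by rw [Subgroup.coe_inv, hs, map_inv])

omit σ in
/-- Ratio bookkeeping (any rank): if `|u_i/u_j| ≤ q` for `i < j` then the same holds for `u⁻¹ ∘ rev`. [cite: Casselman1995, Prop. 1.4.3] -/
theorem inv_rev_ratio_le {q : ValueGroupWithZero K} (u : Fin N → Kˣ)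
    (hu : ∀ i j : Fin N, i < j → valuation K ((u i : K) * ((u j : K))⁻¹) ≤ q) :
    ∀ i j : Fin N, i < j → valuation K (((u⁻¹ ∘ Fin.rev) i : Kˣ) * ((((u⁻¹ ∘ Fin.rev) j : Kˣ) : K))⁻¹) ≤ q := by
  intro i j hij
  have h := hu j.rev i.rev (Fin.rev_lt_rev.2 hij)
  simp only [Function.comp_apply, Pi.inv_apply, Units.val_inv_eq_inv_val, inv_inv]
  rwa [mul_comm]

/-- **Dominance on `N̄ = w₀ N w₀` (`haNbar` ∕ `hbNbar`, quantitative, any rank, any dominant diagonal)**: for `s = diag(u)` with `|u_i∕u_j| ≤ q` (`i < j`),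
`s⁻¹ (K_γ ∩ N̄) s ⊆ K_{γ'} ∩ N̄` whenever `q γ ≤ γ' < 1`. [cite: Casselman1995, Prop. 1.4.3, Prop. 1.4.4] -/
theorem dominant_inv_conj_mem_Nbar {q γ γ' : ValueGroupWithZero K} (hγ' : γ' < 1) (hqγ : q * γ ≤ γ') (s : ↥(unitaryGroupOfForm σ J))
    (u : Fin N → Kˣ) (hs : ((s : ↥(unitaryGroupOfForm σ J)) : GL (Fin N) K) = glDiagonal N K u)
    (hu : ∀ i j : Fin N, i < j → valuation K ((u i : K) * ((u j : K))⁻¹) ≤ q) {x : ↥(unitaryGroupOfForm σ J)}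
    (hx : x ∈ (congruenceGL N γ).comap (unitaryGroupOfForm σ J).subtype ⊓
      ((borelTriple σ J hJ).N).map (MulAut.conj (weylLongU σ hJ)).toMonoidHom) :
    s⁻¹ * x * s ∈ (congruenceGL N γ').comap (unitaryGroupOfForm σ J).subtype ⊓
      ((borelTriple σ J hJ).N).map (MulAut.conj (weylLongU σ hJ)).toMonoidHom := by
  obtain ⟨hxK, hxN⟩ := Subgroup.mem_inf.1 hx
  obtain ⟨n, hn, hnx⟩ := Subgroup.mem_map.1 hxN
  have hw1 : weylLongU σ hJ * weylLongU σ hJ = 1 := mul_eq_one_iff_eq_inv.2 (weylLongU_inv_eq σ hJ).symm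
  have hwinv : (weylLongU σ hJ)⁻¹ = weylLongU σ hJ := weylLongU_inv_eq σ hJ
  have hnx' : x = weylLongU σ hJ * n * weylLongU σ hJ := by
    rw [← hnx, MulEquiv.coe_toMonoidHom, MulAut.conj_apply, hwinv]
  have hnK : n ∈ (congruenceGL N γ).comap (unitaryGroupOfForm σ J).subtype := by
    have : n = weylLongU σ hJ * x * weylLongU σ hJ := by
      rw [hnx']
      simp only [← mul_assoc, hw1, one_mul]
      rw [mul_assoc, hw1, mul_one]
    rw [this]
    exact weylConj_mem_level σ hJ hxK
  set s' : ↥(unitaryGroupOfForm σ J) := weylLongU σ hJ * s⁻¹ * weylLongU σ hJ with hs'def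
  have hmem := AnyRank.diag_conj_mem_of_mem σ hJ hγ' hqγ s' (u⁻¹ ∘ Fin.rev) (coe_weylConj_inv_eq_glDiagonal σ hJ hs)
    (inv_rev_ratio_le u hu) (Subgroup.mem_inf.2 ⟨hnK, hn⟩)
  obtain ⟨hmK, hmN⟩ := Subgroup.mem_inf.1 hmem
  have hre : s⁻¹ * x * s = weylLongU σ hJ * (s' * n * s'⁻¹) * weylLongU σ hJ := by
    rw [hnx', hs'def]
    simp only [_root_.mul_inv_rev, hwinv, inv_inv]
    simp only [← mul_assoc, hw1, one_mul]
    simp only [mul_assoc, hw1, mul_one]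
  rw [hre]
  refine Subgroup.mem_inf.2 ⟨weylConj_mem_level σ hJ hmK, Subgroup.mem_map.2 ⟨_, hmN, ?_⟩⟩
  rw [MulEquiv.coe_toMonoidHom, MulAut.conj_apply, hwinv]

/-- **Powers stay dominant on `N̄`, with shrinking level** (any rank): `s⁻ᵏ (K_γ ∩ N̄) sᵏ ⊆ K_{qᵏ γ} ∩ N̄`. [cite: Casselman1995, Prop. 1.4.3] -/
theorem dominant_pow_inv_conj_mem_Nbar {q γ : ValueGroupWithZero K} (hγ : γ < 1) (hq : q ≤ 1) (s : ↥(unitaryGroupOfForm σ J))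
    (u : Fin N → Kˣ) (hs : ((s : ↥(unitaryGroupOfForm σ J)) : GL (Fin N) K) = glDiagonal N K u)
    (hu : ∀ i j : Fin N, i < j → valuation K ((u i : K) * ((u j : K))⁻¹) ≤ q) (k : ℕ) {x : ↥(unitaryGroupOfForm σ J)}
    (hx : x ∈ (congruenceGL N γ).comap (unitaryGroupOfForm σ J).subtype ⊓
      ((borelTriple σ J hJ).N).map (MulAut.conj (weylLongU σ hJ)).toMonoidHom) :
    (s ^ k)⁻¹ * x * s ^ k ∈ (congruenceGL N (q ^ k * γ)).comap (unitaryGroupOfForm σ J).subtype ⊓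
      ((borelTriple σ J hJ).N).map (MulAut.conj (weylLongU σ hJ)).toMonoidHom := by
  induction k with
  | zero => simpa using hx
  | succ k ih =>
    have hre : (s ^ (k + 1))⁻¹ * x * s ^ (k + 1) = s⁻¹ * ((s ^ k)⁻¹ * x * s ^ k) * s := by rw [pow_succ]; group
    rw [hre]
    have hlt : q ^ (k + 1) * γ < 1 := by
      calc q ^ (k + 1) * γ ≤ 1 * γ := mul_le_mul' (pow_le_one₀ zero_le hq) le_rfl
        _ = γ := one_mul γ
        _ < 1 := hγ
    have heq : q * (q ^ k * γ) ≤ q ^ (k + 1) * γ := by rw [pow_succ']; rw [mul_assoc]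
    exact dominant_inv_conj_mem_Nbar σ hJ hlt heq s u hs hu ih

/-! ### The Iwahori factorisation `K_γ ∩ U = (K_γ ∩ N̄)(K_γ ∩ T)(K_γ ∩ N)` (any rank) -/

/-- **The Iwahori factorisation of `K_γ ∩ U` in the order `N̄ · T · N`** (`γ < 1`, any rank): every `k ∈ K_γ ∩ U` is `n̄ m n` with `n̄ ∈ K_γ ∩ w₀Nw₀`,
`m ∈ K_γ ∩ T`, `n ∈ K_γ ∩ N` (★ `exists_unitriangular_mul_lower_of_mem_unitary_congruenceGL`, ★ `exists_unipotent_mul_torus_of_mem_borelOfForm`, `diagPart_mem_congruenceGL`).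
[cite: Casselman1995, Prop. 1.4.4] [cite: BruhatTits1972, (4.4.4)] -/
theorem coe_level_eq_mul {γ : ValueGroupWithZero K} (hγ : γ < 1) :
    (((congruenceGL N γ).comap (unitaryGroupOfForm σ J).subtype : Subgroup ↥(unitaryGroupOfForm σ J)) : Set ↥(unitaryGroupOfForm σ J)) =
      (((congruenceGL N γ).comap (unitaryGroupOfForm σ J).subtype ⊓
          ((borelTriple σ J hJ).N).map (MulAut.conj (weylLongU σ hJ)).toMonoidHom : Subgroup ↥(unitaryGroupOfForm σ J)) :
            Set ↥(unitaryGroupOfForm σ J)) *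
        (((congruenceGL N γ).comap (unitaryGroupOfForm σ J).subtype ⊓ (borelTriple σ J hJ).M : Subgroup ↥(unitaryGroupOfForm σ J)) :
            Set ↥(unitaryGroupOfForm σ J)) *
        (((congruenceGL N γ).comap (unitaryGroupOfForm σ J).subtype ⊓ (borelTriple σ J hJ).N : Subgroup ↥(unitaryGroupOfForm σ J)) :
            Set ↥(unitaryGroupOfForm σ J)) := by
  have hw1 : weylLongU σ hJ * weylLongU σ hJ = 1 := mul_eq_one_iff_eq_inv.2 (weylLongU_inv_eq σ hJ).symm
  have hwinv : (weylLongU σ hJ)⁻¹ = weylLongU σ hJ := weylLongU_inv_eq σ hJ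
  apply le_antisymm
  · intro k hk
    have hk' : k ∈ (congruenceGL N γ).comap (unitaryGroupOfForm σ J).subtype := hk
    have hkinvK : ((k⁻¹ : ↥(unitaryGroupOfForm σ J)) : GL (Fin N) K) ∈ congruenceGL N γ :=
      Subgroup.mem_comap.1 ((Subgroup.inv_mem _ hk'))
    obtain ⟨u, b, huU, hbU, huN, hbB, huK, hbK, hkub⟩ :=
      exists_unitriangular_mul_lower_of_mem_unitary_congruenceGL σ hγ hJ (k⁻¹ : ↥(unitaryGroupOfForm σ J)).2 hkinvK
    obtain ⟨uU, huUeq⟩ : ∃ uU : ↥(unitaryGroupOfForm σ J), uU = ⟨u, huU⟩ := ⟨_, rfl⟩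
    obtain ⟨cU, hcUeq⟩ : ∃ cU : ↥(unitaryGroupOfForm σ J), cU = ⟨b, hbU⟩⁻¹ := ⟨_, rfl⟩
    have hcoe_u : ((uU : ↥(unitaryGroupOfForm σ J)) : GL (Fin N) K) = u := by rw [huUeq]
    have hcoe_c : ((cU : ↥(unitaryGroupOfForm σ J)) : GL (Fin N) K) = b⁻¹ := by rw [hcUeq, Subgroup.coe_inv]
    have hk_eq : k = cU * uU⁻¹ := by
      apply Subtype.ext
      have h1 : ((k⁻¹ : ↥(unitaryGroupOfForm σ J)) : GL (Fin N) K) = u * b := hkub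
      rw [Subgroup.coe_inv] at h1
      rw [Subgroup.coe_mul, Subgroup.coe_inv, hcoe_c, hcoe_u, ← inv_inv ((k : ↥(unitaryGroupOfForm σ J)) : GL (Fin N) K), h1,
        _root_.mul_inv_rev]
    set b' : ↥(unitaryGroupOfForm σ J) := weylLongU σ hJ * cU * weylLongU σ hJ with hb'def
    have hcK : cU ∈ (congruenceGL N γ).comap (unitaryGroupOfForm σ J).subtype := by
      rw [Subgroup.mem_comap, Subgroup.coe_subtype, hcoe_c]
      exact (congruenceGL N γ).inv_mem hbK
    have hb'K : b' ∈ (congruenceGL N γ).comap (unitaryGroupOfForm σ J).subtype := weylConj_mem_level σ hJ hcK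
    have hb'B : ((b' : ↥(unitaryGroupOfForm σ J)) : GL (Fin N) K) ∈ borelOfForm σ N := by
      rw [← mem_borelU_iff_mem_borelOfForm hJ, mem_borelU_iff]
      intro i j hij
      rw [hb'def, coe_weylConj_apply, hcoe_c]
      have hlow := (mem_oppositeParabolicGL_iff (c := (_root_.id : Fin N → Fin N)) (b⁻¹ : GL (Fin N) K)).1
        ((oppositeParabolicGL K _).inv_mem hbB)
      exact hlow i.rev j.rev (by simpa [Fin.rev_lt_rev] using hij)
    obtain ⟨u', hu', d, hdT, hdiag, hb'ud⟩ := exists_unipotent_mul_torus_of_mem_borelOfForm (σ := σ) (N := N) hb'B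
    have hdU : glDiagonal N K d ∈ unitaryGroupOfForm σ J := by rw [hJ]; exact hdT.1
    have hu'U : u' ∈ unitaryGroupOfForm σ J := by rw [hJ]; exact hu'.1
    set dU : ↥(unitaryGroupOfForm σ J) := ⟨glDiagonal N K d, hdU⟩ with hdUdef
    set u'U : ↥(unitaryGroupOfForm σ J) := ⟨u', hu'U⟩ with hu'Udef
    have hdK : dU ∈ (congruenceGL N γ).comap (unitaryGroupOfForm σ J).subtype := by
      rw [Subgroup.mem_comap]
      exact diagPart_mem_congruenceGL hγ (Subgroup.mem_comap.1 hb'K) d hdiag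
    have hb'_eq : b' = u'U * dU := Subtype.ext hb'ud
    have hu'K : u'U ∈ (congruenceGL N γ).comap (unitaryGroupOfForm σ J).subtype := by
      have : u'U = b' * dU⁻¹ := by rw [hb'_eq, mul_inv_cancel_right]
      rw [this]
      exact Subgroup.mul_mem _ hb'K (Subgroup.inv_mem _ hdK)
    have hu'N : u'U ∈ (borelTriple σ J hJ).N := by
      rw [borelTriple_N]
      exact hu'.2
    have hc_eq : cU = (weylLongU σ hJ * u'U * weylLongU σ hJ) * (weylLongU σ hJ * dU * weylLongU σ hJ) := by
      have : cU = weylLongU σ hJ * b' * weylLongU σ hJ := by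
        rw [hb'def]
        simp only [← mul_assoc, hw1, one_mul]
        rw [mul_assoc, hw1, mul_one]
      rw [this, hb'_eq]
      simp only [mul_assoc, ← mul_assoc (weylLongU σ hJ) (weylLongU σ hJ), hw1, one_mul]
    refine Set.mem_mul.2 ⟨(weylLongU σ hJ * u'U * weylLongU σ hJ) * (weylLongU σ hJ * dU * weylLongU σ hJ),
      Set.mem_mul.2 ⟨weylLongU σ hJ * u'U * weylLongU σ hJ, ?_, weylLongU σ hJ * dU * weylLongU σ hJ, ?_, rfl⟩, uU⁻¹, ?_, ?_⟩
    · refine Subgroup.mem_inf.2 ⟨weylConj_mem_level σ hJ hu'K, Subgroup.mem_map.2 ⟨u'U, hu'N, ?_⟩⟩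
      rw [MulEquiv.coe_toMonoidHom, MulAut.conj_apply, hwinv]
    · refine Subgroup.mem_inf.2 ⟨weylConj_mem_level σ hJ hdK, ?_⟩
      rw [borelTriple_M, mem_torusU_iff]
      exact ⟨d ∘ Fin.rev, (coe_weylConj_of_eq_glDiagonal σ hJ rfl).symm⟩
    · refine Subgroup.mem_inf.2 ⟨Subgroup.inv_mem _ ?_, Subgroup.inv_mem _ ?_⟩
      · rw [Subgroup.mem_comap, Subgroup.coe_subtype, hcoe_u]; exact huK
      · rw [borelTriple_N]
        show ((uU : ↥(unitaryGroupOfForm σ J)) : GL (Fin N) K) ∈ upperUnitriangular (Fin N) K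
        rw [hcoe_u]; exact huN
    · rw [hk_eq, hc_eq]
  · rintro _ ⟨_, ⟨x, hx, y, hy, rfl⟩, z, hz, rfl⟩
    exact Subgroup.mul_mem _ (Subgroup.mul_mem _ (Subgroup.mem_inf.1 hx).1 (Subgroup.mem_inf.1 hy).1) (Subgroup.mem_inf.1 hz).1

omit [ValuativeRel K] in
/-- **`w₀ N w₀` is lower triangular** (any rank). [cite: Rogawski1990, §1.10 p. 9] -/
theorem coe_mem_opposite_of_mem_Nbar {x : ↥(unitaryGroupOfForm σ J)}
    (hx : x ∈ ((borelTriple σ J hJ).N).map (MulAut.conj (weylLongU σ hJ)).toMonoidHom) :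
    ((x : ↥(unitaryGroupOfForm σ J)) : GL (Fin N) K) ∈ oppositeParabolicGL K (_root_.id : Fin N → Fin N) := by
  obtain ⟨n, hn, hnx⟩ := Subgroup.mem_map.1 hx
  have hwinv : (weylLongU σ hJ)⁻¹ = weylLongU σ hJ := weylLongU_inv_eq σ hJ
  have hnx' : x = weylLongU σ hJ * n * weylLongU σ hJ := by rw [← hnx, MulEquiv.coe_toMonoidHom, MulAut.conj_apply, hwinv]
  rw [borelTriple_N] at hn
  have hup := ((mem_unipotentU_iff n).1 hn).1
  rw [mem_oppositeParabolicGL_iff]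
  intro i j hij
  rw [hnx', coe_weylConj_apply]
  exact hup (by simpa [Fin.rev_lt_rev] using hij)

omit [ValuativeRel K] in
/-- A diagonal element of `U` has a lower-triangular (indeed diagonal) matrix (any rank). [cite: Rogawski1990, §1.10 p. 9] -/
theorem coe_mem_opposite_of_mem_M {x : ↥(unitaryGroupOfForm σ J)} (hx : x ∈ (borelTriple σ J hJ).M) :
    ((x : ↥(unitaryGroupOfForm σ J)) : GL (Fin N) K) ∈ oppositeParabolicGL K (_root_.id : Fin N → Fin N) := by
  rw [borelTriple_M, mem_torusU_iff] at hx
  obtain ⟨d, hd⟩ := hx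
  rw [mem_oppositeParabolicGL_iff, ← hd, coe_glDiagonal]
  intro i j hij
  exact Matrix.diagonal_apply_ne _ (ne_of_lt hij)

omit [ValuativeRel K] in
/-- **Uniqueness of the `N`-component in `N̄ · T · N`** (`hinj`, any rank): if `n̄ t n = n̄' t' n'` with `n̄, n̄' ∈ w₀Nw₀`, `t, t' ∈ T`, `n, n' ∈ N`, then `n = n'`
(★ `unitriangular_mul_lower_unique`).  Stated with `T = torusU σ J`, `N = unipotentU σ J` (`= (borelTriple σ J hJ).M ∕ .N` by `rfl`, ★ `borelTriple_M ∕ _N`); at `N = 3`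
it is ★ `nbar_mul_torus_mul_unipotent_inj`. [cite: Casselman1995, Prop. 1.4.4] [cite: BruhatTits1972, (4.4.4)] -/
theorem nbar_torus_unipotent_inj :
    ∀ nb ∈ (unipotentU σ J).map (MulAut.conj (weylLongU σ hJ)).toMonoidHom, ∀ t ∈ torusU σ J,
      ∀ n ∈ unipotentU σ J, ∀ nb' ∈ (unipotentU σ J).map (MulAut.conj (weylLongU σ hJ)).toMonoidHom,
        ∀ t' ∈ torusU σ J, ∀ n' ∈ unipotentU σ J, nb * t * n = nb' * t' * n' → n = n' := by
  intro nb hnb₀ m hm₀ n hn₀ nb' hnb'₀ m' hm'₀ n' hn'₀ h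
  -- the same memberships in the `borelTriple` spelling (`rfl`)
  have hnb : nb ∈ ((borelTriple σ J hJ).N).map (MulAut.conj (weylLongU σ hJ)).toMonoidHom := hnb₀
  have hnb' : nb' ∈ ((borelTriple σ J hJ).N).map (MulAut.conj (weylLongU σ hJ)).toMonoidHom := hnb'₀
  have hm : m ∈ (borelTriple σ J hJ).M := hm₀
  have hm' : m' ∈ (borelTriple σ J hJ).M := hm'₀
  have hn : n ∈ (borelTriple σ J hJ).N := hn₀
  have hn' : n' ∈ (borelTriple σ J hJ).N := hn'₀
  have h' : ((n⁻¹ : ↥(unitaryGroupOfForm σ J)) : GL (Fin N) K) * ((m⁻¹ * nb⁻¹ : ↥(unitaryGroupOfForm σ J)) : GL (Fin N) K) =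
      ((n'⁻¹ : ↥(unitaryGroupOfForm σ J)) : GL (Fin N) K) * ((m'⁻¹ * nb'⁻¹ : ↥(unitaryGroupOfForm σ J)) : GL (Fin N) K) := by
    have hinv := congrArg (fun g : ↥(unitaryGroupOfForm σ J) => ((g⁻¹ : ↥(unitaryGroupOfForm σ J)) : GL (Fin N) K)) h
    simpa only [_root_.mul_inv_rev, Subgroup.coe_mul, mul_assoc] using hinv
  have hnN : ((n⁻¹ : ↥(unitaryGroupOfForm σ J)) : GL (Fin N) K) ∈ upperUnitriangular (Fin N) K := by
    have := (borelTriple σ J hJ).N.inv_mem hn; rw [borelTriple_N] at this; exact this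
  have hn'N : ((n'⁻¹ : ↥(unitaryGroupOfForm σ J)) : GL (Fin N) K) ∈ upperUnitriangular (Fin N) K := by
    have := (borelTriple σ J hJ).N.inv_mem hn'; rw [borelTriple_N] at this; exact this
  have hbB : ((m⁻¹ * nb⁻¹ : ↥(unitaryGroupOfForm σ J)) : GL (Fin N) K) ∈ oppositeParabolicGL K (_root_.id : Fin N → Fin N) := by
    rw [Subgroup.coe_mul]
    exact Subgroup.mul_mem _ (coe_mem_opposite_of_mem_M σ hJ ((borelTriple σ J hJ).M.inv_mem hm))
      (coe_mem_opposite_of_mem_Nbar σ hJ (Subgroup.inv_mem _ hnb))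
  have hb'B : ((m'⁻¹ * nb'⁻¹ : ↥(unitaryGroupOfForm σ J)) : GL (Fin N) K) ∈ oppositeParabolicGL K (_root_.id : Fin N → Fin N) := by
    rw [Subgroup.coe_mul]
    exact Subgroup.mul_mem _ (coe_mem_opposite_of_mem_M σ hJ ((borelTriple σ J hJ).M.inv_mem hm'))
      (coe_mem_opposite_of_mem_Nbar σ hJ (Subgroup.inv_mem _ hnb'))
  have huniq := (unitriangular_mul_lower_unique hnN hn'N hbB hb'B h').1
  have : n⁻¹ = n'⁻¹ := Subtype.ext huniq
  exact inv_injective this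

end Alg

end Summit.HodgeConjecture.HodgeConjecture.Cruxes.H413.F0P3cIwahoriDatumU2

end
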